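import Literature.NumberTheory.Automorphic.GLnLeviOrbitalDescent
import Literature.MeasureTheory.Group.InvariantQuotientNormalized
import HarnessLib

/-!
# Parabolic descent on `GL_n(F)` with CANONICAL quotient measures: the constant is independent of the torus
# `∫_{G⧸T} F(y p y⁻¹) d(ν∕t) = C(ν, ν_M, μ_{G∕M}, κ, μ_U) ‖det(1 − K_p)‖⁻¹ ‖det K_p‖ ∫_{M⧸T} F^{(P)}(m p m⁻¹) d(ν_M∕t)` for EVERY closed `T ≤ M`

Topic `NumberTheory/Automorphic`; namespace `Literature.NumberTheory.Automorphic`. KERNEL mathematics only: one theorem,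
no definition, no named fact, no instance, no `sorry`. Cell `pub/hodgecm-mathlib`, programme P3a, road «D-N6s» brick B2
(«D-S1c-canonical», gap g1 of the D-N6s∕D-N7s censuses): ★ `GLnLeviOrbitalDescent.exists_lintegral_descConj_eq_mul_lintegral_levi`
(D-S1c-β, Rogawski (1990), Lemma 4.13.1 (a) p. 64 and its proof pp. 64–66) fixes the torus `T ≤ M` and the three invariant measures
`μ_{G∕T}`, `μ_{G∕M}`, `μ_{M∕T}` BEFORE producing its constant `∃ C` — its `C = c₁·C_Iw` carries the (hidden) chain-rule constant
`c₁(μ_{G∕T}, μ_{G∕M}, μ_{M∕T})` of ★ `exists_lintegral_eq_mul_lintegral_innerLIntegral`. For the local endoscopic transfer at a split place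
(letter N6: ONE function `φ^H` must serve EVERY `G`-regular `γ_H`, i.e. every torus `T = C_G(γ)`) the constant must not depend on
`T`. It does not when the quotient measures are the CANONICAL ones of the tree (★ `Literature.MeasureTheory.Group.quotientMeasure`
= `dν ∕ dt`, Deitmar–Echterhoff Thm. 1.5.3; the members of a CANONICAL orbital measure family ★ `OrbitalMeasureFamily.IsCanonical`):
by the explicit chain rule ★ `lintegral_eq_unfoldingConstant_mul_lintegral_innerLIntegral` the constant is `u₁ u₂⁻¹ u₃⁻¹` in the three
unfolding constants, and ★ `unfoldingConstant_quotientMeasure` gives `u₁ = u₃ = 1` for `μ_{G∕T} = ν∕t`, `μ_{M∕T} = ν_M∕t′`; hence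

  `C = u(μ_{G∕M}; ν_M, ν)⁻¹ · C_Iw(μ_{G∕M}, κ, μ_U)`   — a function of `ν, ν_M, μ_{G∕M}, κ, μ_U` ONLY.

* **`exists_lintegral_descConj_quotientMeasure_eq_mul_lintegral_levi`** — `∃ C ∈ (0, ∞)`, `∀ T ≤ M` closed, `∀ t` Haar and inversion
  invariant on `T` (with its transport `t′` to `T ⊓ M ≤ M`), `∀ p ∈ P_c ∩ M` centralised by `T` with `det(1 − K_p) ≠ 0`, `∀ F` Borel:
  `∫⁻_{G⧸T} F(y p y⁻¹) d(quotientMeasure T t ν) = C ‖det(1 − K_p)‖⁻¹ ‖det K_p‖ ∫⁻_{M⧸T} (∫⁻_{K×U_c} F(k (m p m⁻¹ u) k⁻¹)) d(quotientMeasure (T⊓M) t′ ν_M)`.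
  The proof is ★ D-S1c-β's, step (1) replaced by the explicit chain rule (adapted from ★ `GLnLeviOrbitalDescent`, whose Iwasawa form ★
  `exists_quotientMeasure_levi_eq_smul_map_bool`, Tonelli step and box substitutions ★ `lintegral_prod_unipotent_conj_eq_mul` ∕ ★
  `lintegral_prod_unipotent_mul_parabolic_eq_mul` are reused by name).
The Bochner reading for continuous compactly supported `F` follows the pattern of ★ `GLnLeviOrbitalDescentBochner` (F0P3-p01); it is
left to the assembly brick B5.

## References
* [Rogawski1990] J. D. Rogawski, *Automorphic Representations of Unitary Groups in Three Variables*, Ann. of Math. Stud. 123 (1990),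
  §4.13 («The case of split primes»), Lemma 4.13.1 (a) p. 64 and its proof pp. 64–66; §4.3 (4.3.1) p. 43 (compatible measures).
* [DeitmarEchterhoff2014] A. Deitmar, S. Echterhoff, *Principles of Harmonic Analysis*, 2nd ed. (2014), Thm. 1.5.3.
* [Folland1995] G. B. Folland, *A Course in Abstract Harmonic Analysis* (1995), §2.6 Thm. 2.49.
-/

set_option autoImplicit false

noncomputable section

open scoped MatrixGroups NNReal ENNReal
open MeasureTheory Measure Matrix Topology

namespace Literature.NumberTheory.Automorphic

open Literature.MeasureTheory.Group
open Literature.NumberTheory.GaloisRepresentations.IsNonarchimedeanLocalField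

variable (F : Type*) [Field F] [ValuativeRel F] [TopologicalSpace F] [IsNonarchimedeanLocalField F]
  [MeasurableSpace F] [BorelSpace F]
  {n : ℕ} {c : Fin n → Bool} [MeasurableSpace (GL (Fin n) F)] [BorelSpace (GL (Fin n) F)]

/-- **Parabolic descent with canonical quotient measures — the constant does not depend on the torus** (Rogawski 1990, Lemma
4.13.1 (a) and its proof, with «compatible measures» §4.3 p. 43). Let `c` be monotone, `M = M_c`, `ν`, `ν_M` Haar measures on
`GL_n(F)` and `M`, `μ_{G∕M}` a non-zero invariant Radon measure on `GL_n(F) ⧸ M`, `κ`, `μ_U` Haar measures on `GL_n(𝒪)` and `U_c`. There is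
ONE `C ∈ (0, ∞)` such that for EVERY closed `T ≤ M`, every Haar inversion-invariant `t` on `T` (`t′` its transport to `T ⊓ M ≤ M`), every
`p ∈ P_c ∩ M` centralised by `T` with `det(1 − K_p) ≠ 0` and every Borel `F ≥ 0`:
`∫⁻_{G⧸T} F(y p y⁻¹) d(ν∕t) = C ‖det(1 − K_p)‖⁻¹ ‖det K_p‖ ∫⁻_{M⧸T} (∫⁻_{K×U_c} F(k ((m p m⁻¹) u) k⁻¹) d(κ ⊗ μ_U)) d(ν_M∕t′)`,
`ν∕t`, `ν_M∕t′` the canonical quotient measures (★ `quotientMeasure`). [cite: Rogawski1990, §4.13 Lemma 4.13.1 (a) pp. 64–66; §4.3 (4.3.1) p. 43]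
[cite: DeitmarEchterhoff2014, Thm. 1.5.3] [cite: Folland1995, §2.6 Thm. 2.49] -/
theorem exists_lintegral_descConj_quotientMeasure_eq_mul_lintegral_levi
    [T2Space (GL (Fin n) F)] [SecondCountableTopology (GL (Fin n) F)] [LocallyCompactSpace (GL (Fin n) F)]
    (hc : Monotone c) {M : Subgroup (GL (Fin n) F)} (hM : M = standardLeviGL F c) [LocallyCompactSpace ↥M]
    [MeasurableSpace (GL (Fin n) F ⧸ M)] [BorelSpace (GL (Fin n) F ⧸ M)]
    (ν : Measure (GL (Fin n) F)) [IsHaarMeasure ν] [ν.IsMulRightInvariant]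
    (νM : Measure ↥M) [IsHaarMeasure νM] [νM.IsMulRightInvariant]
    (μGM : Measure (GL (Fin n) F ⧸ M)) [SMulInvariantMeasure (GL (Fin n) F) (GL (Fin n) F ⧸ M) μGM]
    [IsFiniteMeasureOnCompacts μGM] (hGM : μGM ≠ 0)
    (κ : Measure ↥(glInt n F)) [IsHaarMeasure κ]
    (μN : Measure ↥(unipotentRadicalGL F c)) [IsHaarMeasure μN] :
    ∃ C : ℝ≥0∞, C ≠ 0 ∧ C ≠ ∞ ∧ ∀ (T : Subgroup (GL (Fin n) F)) (hT : IsClosed (T : Set (GL (Fin n) F))) (hTM : T ≤ M)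
      [MeasurableSpace (GL (Fin n) F ⧸ T)] [BorelSpace (GL (Fin n) F ⧸ T)]
      [MeasurableSpace (↥M ⧸ T.subgroupOf M)] [BorelSpace (↥M ⧸ T.subgroupOf M)]
      (t : Measure ↥T) [IsHaarMeasure t] [t.IsInvInvariant]
      (t' : Measure ↥(T.subgroupOf M)) [IsHaarMeasure t'] [t'.IsInvInvariant]
      (_ht' : t' = Measure.map (Subgroup.subgroupOfEquivOfLe hTM).symm t)
      (p : standardParabolicGL F c) (hpM : (p : GL (Fin n) F) ∈ M)
      (hpT : ∀ s ∈ T, s * (p : GL (Fin n) F) = (p : GL (Fin n) F) * s)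
      (_hp : (1 - Matrix.of fun q q' : {i : Fin n // c i = false} × {j : Fin n // c j = true} =>
          ((p : GL (Fin n) F) : Matrix (Fin n) (Fin n) F) q.1 q'.1 *
            (((p⁻¹ : standardParabolicGL F c) : GL (Fin n) F) : Matrix (Fin n) (Fin n) F) q'.2 q.2).det
          ≠ 0)
      (Fn : GL (Fin n) F → ℝ≥0∞), Measurable Fn →
        ∫⁻ y, descConj (p : GL (Fin n) F) T hpT Fn y
            ∂(quotientMeasure T t hT ν) =
          C * ((normAbs F ((1 - Matrix.of
              fun q q' : {i : Fin n // c i = false} × {j : Fin n // c j = true} =>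
                ((p : GL (Fin n) F) : Matrix (Fin n) (Fin n) F) q.1 q'.1 *
                  (((p⁻¹ : standardParabolicGL F c) : GL (Fin n) F) : Matrix (Fin n) (Fin n) F)
                    q'.2 q.2).det)⁻¹ *
            normAbs F (Matrix.of
              fun q q' : {i : Fin n // c i = false} × {j : Fin n // c j = true} =>
                ((p : GL (Fin n) F) : Matrix (Fin n) (Fin n) F) q.1 q'.1 *
                  (((p⁻¹ : standardParabolicGL F c) : GL (Fin n) F) : Matrix (Fin n) (Fin n) F)
                    q'.2 q.2).det : ℝ≥0) : ℝ≥0∞) *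
          ∫⁻ z, descConj (⟨(p : GL (Fin n) F), hpM⟩ : ↥M) (T.subgroupOf M)
              (fun s hs => Subtype.ext (hpT (s : GL (Fin n) F) hs))
              (fun m : ↥M => ∫⁻ q : ↥(glInt n F) × ↥(unipotentRadicalGL F c),
                Fn ((q.1 : GL (Fin n) F) * ((m : GL (Fin n) F) * (q.2 : GL (Fin n) F)) *
                  (q.1 : GL (Fin n) F)⁻¹) ∂(κ.prod μN))
              z ∂(quotientMeasure (T.subgroupOf M) t' (isClosed_subgroupOf T M hT) νM) := by
  subst hM
  haveI : T2Space F := (isLocalField F).toT2Space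
  haveI : SecondCountableTopology F := secondCountableTopology_localField F
  haveI : LocallyCompactSpace F := (isLocalField F).toLocallyCompactSpace
  haveI hMc : IsClosed ((standardLeviGL F c : Subgroup (GL (Fin n) F)) : Set (GL (Fin n) F)) :=
    isClosed_standardLeviGL (R := F) c
  haveI : BorelSpace ↥(unipotentRadicalGL F c) := Subtype.borelSpace _
  haveI : BorelSpace ↥(glInt n F) := Subtype.borelSpace _
  haveI : CompactSpace ↥(glInt n F) := isCompact_iff_compactSpace.1 (isCompact_glInt n F)
  haveI : IsFiniteMeasure κ := CompactSpace.isFiniteMeasure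
  -- `U_c` is second countable locally compact (a box), so `μ_U` is s-finite
  haveI : SecondCountableTopology ↥(unipotentRadicalGL F c) :=
    TopologicalSpace.Subtype.secondCountableTopology _
  haveI : LocallyCompactSpace ↥(unipotentRadicalGL F c) := by
    obtain ⟨Φ, -, -⟩ := exists_boxHomeomorph_unipotentRadicalGL (R := F) c
    exact Φ.symm.isClosedEmbedding.locallyCompactSpace
  haveI : SFinite μN := inferInstance
  haveI : SecondCountableTopology ↥(standardLeviGL F c) :=
    TopologicalSpace.Subtype.secondCountableTopology _
  haveI : SFinite νM := inferInstance
  haveI : SecondCountableTopology ↥(glInt n F) := TopologicalSpace.Subtype.secondCountableTopology _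
  haveI : BorelSpace (↥(glInt n F) × ↥(unipotentRadicalGL F c)) := Prod.borelSpace
  -- the Iwasawa form of `μ_{G/M}` and the constant
  obtain ⟨C, hC, hμGM⟩ := exists_quotientMeasure_levi_eq_smul_map_bool F hc rfl μGM hGM κ μN
  have hνM0 : νM ≠ 0 := fun h => by
    have h2 : 0 < νM Set.univ := isOpen_univ.measure_pos νM ⟨1, trivial⟩
    rw [h] at h2; exact lt_irrefl _ h2
  have hu2 : (unfoldingConstant (standardLeviGL F c) νM μGM ν : ℝ≥0∞) ≠ 0 :=
    ENNReal.coe_ne_zero.2 (unfoldingConstant_pos (standardLeviGL F c) νM μGM ν hGM hνM0).ne'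
  refine ⟨(unfoldingConstant (standardLeviGL F c) νM μGM ν : ℝ≥0∞)⁻¹ * C,
    mul_ne_zero (ENNReal.inv_ne_zero.2 ENNReal.coe_ne_top) (ENNReal.coe_ne_zero.2 hC),
    ENNReal.mul_ne_top (ENNReal.inv_ne_top.2 hu2) ENNReal.coe_ne_top, ?_⟩
  intro T hT hTM _ _ _ _ t _ _ t' _ _ ht' p hpM hpT hp Fn hFn
  haveI : IsClosed (T : Set (GL (Fin n) F)) := hT
  haveI : SecondCountableTopology ↥T := TopologicalSpace.Subtype.secondCountableTopology _
  haveI : LocallyCompactSpace ↥T := hT.isClosedEmbedding_subtypeVal.locallyCompactSpace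
  haveI : SFinite t := inferInstance
  haveI : IsClosed ((T.subgroupOf (standardLeviGL F c) : Subgroup ↥(standardLeviGL F c)) : Set ↥(standardLeviGL F c)) :=
    isClosed_subgroupOf T (standardLeviGL F c) hT
  haveI : SecondCountableTopology ↥(T.subgroupOf (standardLeviGL F c)) :=
    TopologicalSpace.Subtype.secondCountableTopology _
  haveI : LocallyCompactSpace ↥(T.subgroupOf (standardLeviGL F c)) :=
    (isClosed_subgroupOf T (standardLeviGL F c) hT).isClosedEmbedding_subtypeVal.locallyCompactSpace
  haveI : SFinite t' := inferInstance
  haveI : SecondCountableTopology (↥(standardLeviGL F c) ⧸ T.subgroupOf (standardLeviGL F c)) := inferInstance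
  haveI : BorelSpace ((↥(glInt n F) × ↥(unipotentRadicalGL F c)) ×
      (↥(standardLeviGL F c) ⧸ T.subgroupOf (standardLeviGL F c))) := Prod.borelSpace
  haveI : SFinite (quotientMeasure (T.subgroupOf (standardLeviGL F c)) t'
    (isClosed_subgroupOf T (standardLeviGL F c) hT) νM) := inferInstance
  have hMT : quotientMeasure (T.subgroupOf (standardLeviGL F c)) t' (isClosed_subgroupOf T (standardLeviGL F c) hT) νM ≠ 0 :=
    quotientMeasure_ne_zero _ _ _ _
  -- (1) the chain rule with explicit constant: `u₁ = u₃ = 1`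
  have hπ : Measurable fun q : ↥(glInt n F) × ↥(unipotentRadicalGL F c) =>
      (QuotientGroup.mk ((q.1 : GL (Fin n) F) * (q.2 : GL (Fin n) F)) :
        GL (Fin n) F ⧸ standardLeviGL F c) :=
    ((QuotientGroup.continuous_mk (N := standardLeviGL F c)).comp
      ((continuous_subtype_val.comp continuous_fst).mul
        (continuous_subtype_val.comp continuous_snd))).measurable
  have hf : Measurable (descConj (p : GL (Fin n) F) T hpT Fn) := measurable_descConj _ _ _ hFn
  have hchain := lintegral_eq_unfoldingConstant_mul_lintegral_innerLIntegral T (standardLeviGL F c)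
    (quotientMeasure T t hT ν) μGM
    (quotientMeasure (T.subgroupOf (standardLeviGL F c)) t' (isClosed_subgroupOf T (standardLeviGL F c) hT) νM)
    ν νM t t' hTM ht' hGM hMT hf
  rw [unfoldingConstant_quotientMeasure T t ν,
    unfoldingConstant_quotientMeasure (T.subgroupOf (standardLeviGL F c)) t' νM] at hchain
  have hint : ∫⁻ y, innerLIntegral T (standardLeviGL F c)
        (quotientMeasure (T.subgroupOf (standardLeviGL F c)) t' (isClosed_subgroupOf T (standardLeviGL F c) hT) νM)
        (descConj (p : GL (Fin n) F) T hpT Fn) y ∂μGM =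
      ∫⁻ y, innerLIntegral T (standardLeviGL F c)
        (quotientMeasure (T.subgroupOf (standardLeviGL F c)) t' (isClosed_subgroupOf T (standardLeviGL F c) hT) νM)
        (descConj (p : GL (Fin n) F) T hpT Fn) y ∂(C • Measure.map
          (fun q : ↥(glInt n F) × ↥(unipotentRadicalGL F c) =>
            (QuotientGroup.mk ((q.1 : GL (Fin n) F) * (q.2 : GL (Fin n) F)) : GL (Fin n) F ⧸ standardLeviGL F c))
          (κ.prod μN)) := by
    rw [← hμGM]
  rw [hchain, ENNReal.coe_one, one_mul, inv_one, mul_one, hint, lintegral_smul_measure,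
    lintegral_map (measurable_innerLIntegral T (standardLeviGL F c)
      (quotientMeasure (T.subgroupOf (standardLeviGL F c)) t' (isClosed_subgroupOf T (standardLeviGL F c) hT) νM)
      (isClosed_standardLeviGL (R := F) c) hf) hπ]
  have hmk : ∀ q : ↥(glInt n F) × ↥(unipotentRadicalGL F c),
      innerLIntegral T (standardLeviGL F c)
        (quotientMeasure (T.subgroupOf (standardLeviGL F c)) t' (isClosed_subgroupOf T (standardLeviGL F c) hT) νM)
        (descConj (p : GL (Fin n) F) T hpT Fn)
        (QuotientGroup.mk ((q.1 : GL (Fin n) F) * (q.2 : GL (Fin n) F))) =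
      ∫⁻ z, descConj (p : GL (Fin n) F) T hpT Fn
        (((q.1 : GL (Fin n) F) * (q.2 : GL (Fin n) F)) • inclQuot T (standardLeviGL F c) z)
          ∂(quotientMeasure (T.subgroupOf (standardLeviGL F c)) t' (isClosed_subgroupOf T (standardLeviGL F c) hT) νM) :=
    fun q => innerLIntegral_mk _ _ _ _ _
  rw [lintegral_congr hmk]
  -- (2) Tonelli: swap `K × U_c` and `M ⧸ T`
  have hjoint : Measurable fun r : (↥(glInt n F) × ↥(unipotentRadicalGL F c)) ×
      (↥(standardLeviGL F c) ⧸ T.subgroupOf (standardLeviGL F c)) =>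
      descConj (p : GL (Fin n) F) T hpT Fn
        (((r.1.1 : GL (Fin n) F) * (r.1.2 : GL (Fin n) F)) • inclQuot T (standardLeviGL F c) r.2) :=
    hf.comp ((((continuous_subtype_val.comp continuous_fst).mul
      (continuous_subtype_val.comp continuous_snd)).comp continuous_fst).smul
      ((continuous_inclQuot T (standardLeviGL F c)).comp continuous_snd)).measurable
  rw [lintegral_lintegral_swap hjoint.aemeasurable]
  -- (3) the inner `K × U_c` integral at `z = mT`: the two substitutions at `m p m⁻¹`
  have hinner : ∀ z : ↥(standardLeviGL F c) ⧸ T.subgroupOf (standardLeviGL F c),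
      ∫⁻ q : ↥(glInt n F) × ↥(unipotentRadicalGL F c), descConj (p : GL (Fin n) F) T hpT Fn
          (((q.1 : GL (Fin n) F) * (q.2 : GL (Fin n) F)) • inclQuot T (standardLeviGL F c) z)
            ∂(κ.prod μN) =
        ((normAbs F ((1 - Matrix.of
              fun q q' : {i : Fin n // c i = false} × {j : Fin n // c j = true} =>
                ((p : GL (Fin n) F) : Matrix (Fin n) (Fin n) F) q.1 q'.1 *
                  (((p⁻¹ : standardParabolicGL F c) : GL (Fin n) F) : Matrix (Fin n) (Fin n) F)
                    q'.2 q.2).det)⁻¹ *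
            normAbs F (Matrix.of
              fun q q' : {i : Fin n // c i = false} × {j : Fin n // c j = true} =>
                ((p : GL (Fin n) F) : Matrix (Fin n) (Fin n) F) q.1 q'.1 *
                  (((p⁻¹ : standardParabolicGL F c) : GL (Fin n) F) : Matrix (Fin n) (Fin n) F)
                    q'.2 q.2).det : ℝ≥0) : ℝ≥0∞) *
          descConj (⟨(p : GL (Fin n) F), hpM⟩ : ↥(standardLeviGL F c))
            (T.subgroupOf (standardLeviGL F c)) (fun s hs => Subtype.ext (hpT (s : GL (Fin n) F) hs))
            (fun m : ↥(standardLeviGL F c) => ∫⁻ q : ↥(glInt n F) × ↥(unipotentRadicalGL F c),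
              Fn ((q.1 : GL (Fin n) F) * ((m : GL (Fin n) F) * (q.2 : GL (Fin n) F)) *
                (q.1 : GL (Fin n) F)⁻¹) ∂(κ.prod μN)) z := by
    intro z
    induction z using QuotientGroup.induction_on with
    | H m =>
      obtain ⟨mP, hmP⟩ : ∃ mP : standardParabolicGL F c, (mP : GL (Fin n) F) = (m : GL (Fin n) F) :=
        ⟨⟨(m : GL (Fin n) F), standardLeviGL_le F c m.2⟩, rfl⟩
      have hconj_coe : ((mP * p * mP⁻¹ : standardParabolicGL F c) : GL (Fin n) F) =
          (m : GL (Fin n) F) * (p : GL (Fin n) F) * (m : GL (Fin n) F)⁻¹ := by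
        rw [Subgroup.coe_mul, Subgroup.coe_mul, Subgroup.coe_inv, hmP]
      have hcoeM : ((m * ⟨(p : GL (Fin n) F), hpM⟩ * m⁻¹ : ↥(standardLeviGL F c)) : GL (Fin n) F) =
          (m : GL (Fin n) F) * (p : GL (Fin n) F) * (m : GL (Fin n) F)⁻¹ := by
        rw [Subgroup.coe_mul, Subgroup.coe_mul, Subgroup.coe_inv]
      have hpt : ∀ q : ↥(glInt n F) × ↥(unipotentRadicalGL F c),
          descConj (p : GL (Fin n) F) T hpT Fn
            (((q.1 : GL (Fin n) F) * (q.2 : GL (Fin n) F)) •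
              inclQuot T (standardLeviGL F c) (QuotientGroup.mk m)) =
          Fn ((q.1 : GL (Fin n) F) * (q.2 : GL (Fin n) F) * ((mP * p * mP⁻¹ : standardParabolicGL F c) :
              GL (Fin n) F) * ((q.1 : GL (Fin n) F) * (q.2 : GL (Fin n) F))⁻¹) := by
        intro q
        rw [inclQuot_mk, MulAction.Quotient.smul_mk, smul_eq_mul, descConj_mk, hconj_coe]
        congr 1
        simp only [_root_.mul_inv_rev]
        group
      rw [lintegral_congr hpt, lintegral_prod_unipotent_conj_eq_mul κ
          (fun k : ↥(glInt n F) => (k : GL (Fin n) F)) μN (mP * p * mP⁻¹)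
          (by rw [det_one_sub_boxAd_conj_eq]; exact hp),
        lintegral_prod_unipotent_mul_parabolic_eq_mul κ (fun k : ↥(glInt n F) => (k : GL (Fin n) F)) μN
          (mP * p * mP⁻¹),
        det_one_sub_boxAd_conj_eq, det_boxAd_conj_eq, descConj_mk, ← mul_assoc, ENNReal.coe_mul]
      simp only [hconj_coe, hcoeM]
  rw [lintegral_congr hinner, lintegral_const_mul' _ _ ENNReal.coe_ne_top, ENNReal.smul_def,
    smul_eq_mul, ← mul_assoc, ← mul_assoc]

end Literature.NumberTheory.Automorphic

end
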